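import Summits.HodgeConjecture.CorCM.MumfordTateRankSimpleSurfaces
import Summits.HodgeConjecture.CorCM.MumfordTateRankSubadditive
import Summits.HodgeConjecture.CorCM.MumfordTateRankSixCMRank
import Summits.HodgeConjecture.CorCM.MumfordTateRankTwoEndomorphism
import Summits.HodgeConjecture.CorCM.MumfordTateRankSevenSplitIsogeny
import Literature.AlgebraicGeometry.Motives.AbelianVarietyIsogenousProductOfSimples
import Literature.AlgebraicGeometry.Motives.AbelianVarietyPoincareCompleteReducibility
import HarnessLib

/-!
# The Mumford–Tate rank of a complex abelian surface: `t ∈ {2, 3, 4, 5, 7, 11}`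

Sub-problem `CorCM` of `HodgeConjecture` (cell `pub-hodgecm2`, count-neutral Mumford–Tate-rank lane of seat `b27`; theorems only,
no new definition, no named fact; nothing here uses or asserts `HC_CM`).  For EVERY complex abelian surface `X`,
`t(X) = dim MT(H¹X) ∈ {2, 3, 4, 5, 7, 11}`:

* `X` simple: `t ∈ {3, 4, 7, 11}` (`CorCM/MumfordTateRankSimpleSurfaces`);
* `X` not simple: `X ∼ Y × Z` with `Y, Z` elliptic curves (Poincaré's complete reducibility), so
  `t(X) + 1 ≤ t(Y) + t(Z) ≤ 4 + 4` (`CorCM/MumfordTateRankSubadditive`, and `t(E) ≤ 1·3 + 1` for a curve,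
  `CorCM/MumfordTateRankTrivialEndomorphisms`), `t ≥ 2`;
* `t ≠ 6` for surfaces: `t = 6` forces `X ∼ B^{m+1} × Z` with `Z` of CM type and `t(Z) = 3 > dim Z + 1` unless `dim Z ≥ 2`,
  so `dim X ≥ 3` (`CorCM/MumfordTateRankSixCMRank`, `CorCM/MumfordTateRankOfCMAbelianVariety`).

Also: `t = 11 ⟹ X` simple with `End⁰X = ℚ`; CM surfaces have `t ∈ {2, 3}`, non-CM ones `t ∈ {4, 5, 7, 11}`.
(The values are attained: `E²` with `E` CM (`2`), `E × E'` CM non-isogenous or a simple CM surface (`3`), `E²` non-CM or a QM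
surface (`4`), `E_CM × E` (`5`), `E × E'` non-CM non-isogenous or an RM surface (`7`), `End⁰X = ℚ` (`11`) — not claimed here.)

## References
* [MoonenZarhin1999LowDim] B. Moonen, Yu. G. Zarhin, *Hodge classes on abelian varieties of low dimension*, Math. Ann. 315 (1999), §2.
* [MumfordAV1970] D. Mumford, *Abelian Varieties* (1970), §19 Thm. 1 (Poincaré), Cor. 2.
-/

noncomputable section

namespace Summit.HodgeConjecture.CorCM

open scoped TensorProduct
open CategoryTheory CategoryTheory.Limits Module
open Literature.AlgebraicGeometry.Motives
open Literature.AlgebraicGeometry.Motives.AbelianVariety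
open Literature.AlgebraicGeometry.Motives.HodgeStructure
open Literature.AlgebraicGeometry.HodgeTheory
open Literature.AlgebraicGeometry.Milne1999 (IsOfCMType)

variable [HodgeTensorFacts.{0, 0}]

/-- **`t ≠ 6` for abelian surfaces.**  `t(X) = 6` (so `X` is not of CM type) gives `X ∼ B^{m+1} × Z` with `B` simple of positive
dimension, `Z` of CM type, `dim Z > 0` and `t(Z) = 3`; but `t(Z) ≤ dim Z + 1` for CM `Z`, so `dim Z ≥ 2` and `dim X ≥ 3`.
[cite: MoonenZarhin1999LowDim, §2] -/
theorem mtRank_hodge_one_ne_six_of_surface {X : AbelianVariety ℂ} {n : ℕ} (hX : IsSmoothProjective n X.X) (hX2 : X.dim = 2) :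
    haveI := BettiUniverse.finite hX 1
    (BettiUniverse.hodge exists_isReal_hodgeModel_holds hX 1).mtRank ≠ 6 := by
  haveI := BettiUniverse.finite hX 1
  intro h6
  have h0 : 0 < X.dim := by omega
  have hcm : ¬ IsOfCMType X := fun hcm => by
    have h := mtRank_hodge_one_le_dim_add_one_of_isOfCMType hX h0 hcm
    omega
  obtain ⟨B, Z, m, -, hB0, -, -, -, -, hZcm, -, hdims, hZ0, -, -, hZ3, -⟩ :=
    exists_isIsogenous_powSucc_prod_finrank_hodgeLie_of_mtRank_le_six hX h0 hcm h6.le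
  have hZpos : 0 < Z.dim := by
    rcases Nat.eq_zero_or_pos Z.dim with hz | hz
    · have h4 := hZ0.1 hz
      omega
    · exact hz
  have hZ3' := hZ3 hZpos
  have hZle := mtRank_hodge_one_le_dim_add_one_of_isOfCMType (AbelianVariety.isSmoothProjective_holds (A := Z)) hZpos hZcm
  have hB1 : B.dim ≤ (m + 1) * B.dim := Nat.le_mul_of_pos_left _ (Nat.succ_pos m)
  omega

omit [HodgeTensorFacts.{0, 0}] in
/-- **A non-simple abelian surface is isogenous to a product of two elliptic curves** (Poincaré's complete reducibility).
[cite: MumfordAV1970, §19 Thm. 1] -/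
theorem exists_isIsogenous_prod_of_not_isSimple_surface {X : AbelianVariety ℂ} (hX2 : X.dim = 2) (hns : ¬ X.IsSimple) :
    ∃ Y Z : AbelianVariety ℂ, Y.dim = 1 ∧ Z.dim = 1 ∧ IsIsogenous X (Y.prod Z) := by
  obtain ⟨Y, i, hi, hY0, hYX⟩ := exists_abelianSubvariety_of_not_isSimple hns
  haveI := hi
  obtain ⟨Z, j, -, hiso⟩ := poincare_complete_reducibility i
  have h1 : IsIsogenous (Y ⊞ Z) X := ⟨_, hiso⟩
  have h2 : IsIsogenous (Y ⊞ Z) (Y.prod Z) := ⟨(biprodIsoProd Y Z).hom, isIsogeny_hom_of_iso _⟩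
  have hXYZ : IsIsogenous X (Y.prod Z) := h1.symm'.trans h2
  have hdim : X.dim = Y.dim + Z.dim := by
    obtain ⟨u, hu⟩ := hXYZ
    rw [dim_eq_of_isIsogeny hu, dim_prod]
  exact ⟨Y, Z, by omega, by omega, hXYZ⟩

/-- **`2 ≤ t ≤ 7` for a non-simple abelian surface**: `X ∼ Y × Z` with elliptic curves `Y, Z`, `t(X) + 1 ≤ t(Y) + t(Z) ≤ 8`.
[cite: MoonenZarhin1999LowDim, §2] [cite: MumfordAV1970, §19 Thm. 1] -/
theorem mtRank_hodge_one_le_seven_of_not_isSimple_surface {X : AbelianVariety ℂ} {n : ℕ} (hX : IsSmoothProjective n X.X)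
    (hX2 : X.dim = 2) (hns : ¬ X.IsSimple) :
    haveI := BettiUniverse.finite hX 1
    2 ≤ (BettiUniverse.hodge exists_isReal_hodgeModel_holds hX 1).mtRank ∧
      (BettiUniverse.hodge exists_isReal_hodgeModel_holds hX 1).mtRank ≤ 7 := by
  haveI := BettiUniverse.finite hX 1
  obtain ⟨Y, Z, hY1, hZ1, hXYZ⟩ := exists_isIsogenous_prod_of_not_isSimple_surface hX2 hns
  have hY := AbelianVariety.isSmoothProjective_holds (A := Y)
  have hZ := AbelianVariety.isSmoothProjective_holds (A := Z)
  have hsub := mtRank_hodge_one_add_one_le_add_of_isIsogenous_prod hY hZ (by omega) (by omega) hX hXYZ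
  have hY4 := mtRank_hodge_one_le_symplectic hY (by omega)
  have hZ4 := mtRank_hodge_one_le_symplectic hZ (by omega)
  have e1 : Y.dim * (2 * Y.dim + 1) + 1 = 4 := by rw [hY1]
  have e2 : Z.dim * (2 * Z.dim + 1) + 1 = 4 := by rw [hZ1]
  exact ⟨two_le_mtRank_hodge_one hX (by omega), by omega⟩

/-- **The Mumford–Tate rank of a complex abelian surface is in `{2, 3, 4, 5, 7, 11}`.** [cite: MoonenZarhin1999LowDim, §2] -/
theorem mtRank_hodge_one_mem_of_surface {X : AbelianVariety ℂ} {n : ℕ} (hX : IsSmoothProjective n X.X) (hX2 : X.dim = 2) :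
    haveI := BettiUniverse.finite hX 1
    (BettiUniverse.hodge exists_isReal_hodgeModel_holds hX 1).mtRank = 2 ∨
      (BettiUniverse.hodge exists_isReal_hodgeModel_holds hX 1).mtRank = 3 ∨
      (BettiUniverse.hodge exists_isReal_hodgeModel_holds hX 1).mtRank = 4 ∨
      (BettiUniverse.hodge exists_isReal_hodgeModel_holds hX 1).mtRank = 5 ∨
      (BettiUniverse.hodge exists_isReal_hodgeModel_holds hX 1).mtRank = 7 ∨
      (BettiUniverse.hodge exists_isReal_hodgeModel_holds hX 1).mtRank = 11 := by
  haveI := BettiUniverse.finite hX 1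
  have h6 := mtRank_hodge_one_ne_six_of_surface hX hX2
  by_cases hs : X.IsSimple
  · rcases mtRank_hodge_one_mem_of_isSimple_surface hX hs hX2 with h | h | h | h <;> omega
  · obtain ⟨h2, h7⟩ := mtRank_hodge_one_le_seven_of_not_isSimple_surface hX hX2 hs
    omega

/-- **A SIMPLE abelian surface is never of Mumford–Tate rank `2` or `5`; a NON-simple one is never of rank `11`.**
[cite: MoonenZarhin1999LowDim, §2] -/
theorem isSimple_iff_of_surface_of_mtRank {X : AbelianVariety ℂ} {n : ℕ} (hX : IsSmoothProjective n X.X) (hX2 : X.dim = 2) :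
    haveI := BettiUniverse.finite hX 1
    ((BettiUniverse.hodge exists_isReal_hodgeModel_holds hX 1).mtRank = 11 → X.IsSimple) ∧
      ((BettiUniverse.hodge exists_isReal_hodgeModel_holds hX 1).mtRank = 2 ∨
        (BettiUniverse.hodge exists_isReal_hodgeModel_holds hX 1).mtRank = 5 → ¬ X.IsSimple) := by
  haveI := BettiUniverse.finite hX 1
  refine ⟨fun h11 => ?_, fun h25 hs => ?_⟩
  · by_contra hs
    have h := (mtRank_hodge_one_le_seven_of_not_isSimple_surface hX hX2 hs).2
    omega
  · rcases mtRank_hodge_one_mem_of_isSimple_surface hX hs hX2 with h | h | h | h <;> omega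

/-- **`t = 11` characterises the generic surface from above:** an abelian surface with `dim MT(H¹X) = 11` is SIMPLE with
`End⁰X = ℚ`. [cite: MoonenZarhin1999LowDim, §2 (2.2)] -/
theorem isSimple_and_finrank_endAlgebra_eq_one_of_surface_of_mtRank_eq_eleven {X : AbelianVariety ℂ} {n : ℕ}
    (hX : IsSmoothProjective n X.X) (hX2 : X.dim = 2)
    (h11 : haveI := BettiUniverse.finite hX 1
      (BettiUniverse.hodge exists_isReal_hodgeModel_holds hX 1).mtRank = 11) :
    X.IsSimple ∧ Module.finrank ℚ X.endAlgebra = 1 := by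
  have hs : X.IsSimple := (isSimple_iff_of_surface_of_mtRank hX hX2).1 h11
  refine ⟨hs, ?_⟩
  rcases mtRank_hodge_one_of_isSimple_surface hX hs hX2 with ⟨h1, -⟩ | ⟨-, h⟩ | ⟨-, -, -, h⟩ | ⟨-, -, h⟩
  · exact h1
  all_goals omega

/-- **CM versus non-CM surfaces:** `t ∈ {2, 3}` if `X` is of CM type, `t ∈ {4, 5, 7, 11}` otherwise.
[cite: MoonenZarhin1999LowDim, §2] -/
theorem mtRank_hodge_one_mem_of_surface_cm_or_not {X : AbelianVariety ℂ} {n : ℕ} (hX : IsSmoothProjective n X.X)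
    (hX2 : X.dim = 2) :
    haveI := BettiUniverse.finite hX 1
    (IsOfCMType X → (BettiUniverse.hodge exists_isReal_hodgeModel_holds hX 1).mtRank = 2 ∨
        (BettiUniverse.hodge exists_isReal_hodgeModel_holds hX 1).mtRank = 3) ∧
      (¬ IsOfCMType X → (BettiUniverse.hodge exists_isReal_hodgeModel_holds hX 1).mtRank = 4 ∨
        (BettiUniverse.hodge exists_isReal_hodgeModel_holds hX 1).mtRank = 5 ∨
        (BettiUniverse.hodge exists_isReal_hodgeModel_holds hX 1).mtRank = 7 ∨
        (BettiUniverse.hodge exists_isReal_hodgeModel_holds hX 1).mtRank = 11) := by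
  haveI := BettiUniverse.finite hX 1
  have hmem := mtRank_hodge_one_mem_of_surface hX hX2
  refine ⟨fun hcm => ?_, fun hcm => ?_⟩
  · have h := mtRank_hodge_one_le_dim_add_one_of_isOfCMType hX (by omega) hcm
    omega
  · have h := four_le_mtRank_hodge_one_of_not_isOfCMType hX hcm
    omega

end Summit.HodgeConjecture.CorCM

end
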